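import Summits.HodgeConjecture.HodgeConjecture.Theorems.Ring2AbelianAllAndreFibreClassOnPath
import HarnessLib

/-!
# Ring 2 · sub-cell AbelianAll (ALL ABELIAN VARIETIES), André axis, part X-c — the POINTWISE fibre-class
# Lefschetz node: on-path modulo Deligne's kernel identity ALONE (fibre-class constancy dropped), the kernel
# identity reduced to ONE fibre by the tree's flatness theorem, and `HC ⊢ (β∀′ᵖᵗ) ⟺ (κ)`

HONEST FRAMING (page 1, verbatim): **research route, not a corollary; conditional on HC_CM plus one named
minimal statement.** Cell line: research route conditional on HC_CM; not a corollary; Q11.4-sentence-2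
already refuted in dim ≥ 3. Nothing in this file proves a case of the Hodge conjecture. `HC_CM` =
`Theses.RankFourFaces.CMAbelianHodge` (a BINDER), `HC_AV` = `Theses.PadicSemiregularLift.HodgeAbelianVarieties`,
item `Theses.RankFourFaces.CMToAbelian` (stmt-16267) OPEN and not closed here. Seat `pub-hodge-ring2-ab-andre-2`,
gen 3; sequel of part X-b (`Ring2AbelianAllAndreFibreClassOnPath`: `(β′_f) ⟺ (κ_f) ∧ (A_f)`,
`HC ⟹[κ, φ] (β∀′)`).

## Two sharpenings of part X-b (everything PROVED; no new supply node)

1. **The supply node (κ) reduces to ONE fibre.** Part X-b's `FibreGysinKernelOn hf` quantifies two fibres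
   (`L_t W = 0 ⟹ j_s^* W = 0`); its "change of fibre" half IS a tree theorem — André's flatness input (A4),
   `Andre1996_deformation_hflat` (a global class vanishing on one fibre vanishes on every fibre of a smooth
   projective family over a connected base; Ehresmann + parallel transport, PROVED in
   `MotivatedClassesDeformationInputs`). Hence `fibreGysinKernelOn_iff_sameFibre`:
   **(κ_f) ⟺ ∀ p t W, `j_{t*} j_t^* W = 0 ⟹ j_t^* W = 0`** — what remains outside the tree is exactly
   "`Ker j_{t*} ∩ Im j_t^* = 0`" (de Cataldo 2007 Ex. 8.5.2: ⟺ the intersection form of the fibre is non-degenerate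
   on `Im j_t^*`; true by global invariant cycles + complete reducibility, Deligne 1971 4.1.1/4.2.6).
2. **The POINTWISE node (β′ᵖᵗ) needs no fibre-class constancy.** Every consumer of (β′) (parts V–IX: the lift
   engine `exists_algebraic_lift_of_fibreClassLefschetzOn`) uses the correspondence `T` at ONE fibre `t` (where the
   class is known to be algebraic) and then all `s`. So the node may let `T` depend on `t`:
   `FibreClassLefschetzPointwiseOn hf := ∀ p ≤ d, ∀ t, ∃ T_t algebraic, ∀ W s, j_s^* T_t L_t W = j_s^* W`. THEOREMS:
   (β′_f) ⟹ (β′ᵖᵗ_f); (β′ᵖᵗ_f) ⟹ (κ_f); the lift engine and the edges (β∀′ᵖᵗ) ⟹ (L∀) ⟹ (2), (β′ᵖᵗ) ⟹ (L) ⟹ (4),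
   (β′ᵖᵗ) ⟹ (3); and — the point — **`HC(𝒳 × 𝒳) ∧ (κ_f) ⟹ (β′ᵖᵗ_f)` with NO (φ)** (part X-b's per-fibre algebraic
   quasi-inverse `exists_algebraic_quasiInverse_fiberGysin_of_hodgeConjectureFor`), universally
   **`HodgeConjecture → (κ) → (β∀′ᵖᵗ)`**, and since (κ) ⊆ (β∀′ᵖᵗ):
   **`HodgeConjecture → ((β∀′ᵖᵗ) ↔ (κ))`** (`fibreClassLefschetzPointwiseCompactPencils_iff_kernel_of_hodgeConjecture`)
   — under the Hodge conjecture the pointwise fibre-class Lefschetz node IS Deligne's invariant-cycle kernel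
   identity, a theorem of Hodge theory; its distance from "on-path, fact-free" is exactly the tree's missing
   E₂-degeneration/semisimplicity package, and nothing cycle-theoretic.

References: DeligneHodgeII1971 (Thm. 4.1.1, 4.2.6); Decataldo2007 (Thm. 8.2.4, 8.4.1, Ex. 8.5.2–8.5.3);
VoisinHodgeII2003 (§3.1.2, §4.3.3 Thm. 4.24); Andre1996Motifs (§5.1 p. 25 (A4), Remarque 2); Abdulali1994FamiliesAV
(Conj. 5.3, Thm. 5.5); Voisin2025 (Prop. 2.11, §3.2.2); Milne2020HodgeClassesAV (Prop. 1).
-/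

noncomputable section

set_option linter.dupNamespace false

namespace Summit.HodgeConjecture.HodgeConjecture.Ring2.AbelianAll

open CategoryTheory AlgebraicGeometry MonoidalCategory
open Literature.AlgebraicGeometry Literature.AlgebraicGeometry.Motives
open Literature.AlgebraicGeometry.HodgeTheory
open Literature.AlgebraicGeometry.Abdulali1994 (InvariantCyclesHoldFor)
open Literature.AlgebraicGeometry.Andre1996 (andre1996_cmAnchoredPencil)
open Literature.AlgebraicGeometry.Deligne1982 (cmLocus)
open Summit.HodgeConjecture.HodgeConjecture
open Summit.HodgeConjecture.HodgeConjecture.Theses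
open Summit.HodgeConjecture.HodgeConjecture.Ring2.Deform (CompactAbelianPencilVHC)

variable {𝒳 S : SchemeOver ℂ}

/-! ## §1 The kernel identity reduces to one fibre (André's flatness input (A4) is a tree theorem) -/

/-- **Change of fibre is a theorem**: on a compact pencil, a global class vanishing on one fibre vanishes on
every fibre (the tree's PROVED `Andre1996_deformation_hflat`: flat sections of `R^k f_* ℂ` over the connected
`S(ℂ)`; André §5.1 input (A4); Voisin II §3.1.2). [cite: Andre1996Motifs, §5.1 (p. 25)] [cite: VoisinHodgeII2003, §3.1.2] -/
theorem map_fiberι_eq_zero_of_eq_zero {d : ℕ} {f : 𝒳 ⟶ S} (hf : IsCompactAbelianPencil f d) {k : ℕ}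
    {W : complexBetti 𝒳 k} {t : ComplexPoints S} (ht : complexBetti.map (fiberι f t) k W = 0)
    (s : ComplexPoints S) : complexBetti.map (fiberι f s) k W = 0 :=
  Andre1996_deformation_hflat f hf.isSmoothProjectiveFamily (Andre1996.compactPencil_smooth_base hf)
    (IsQuasiProjectiveOver.of_isProjectiveOver hf.isSmoothProjective_base.isProjectiveOver)
    (connectedSpace_complexPoints hf.isSmoothProjective_base) k W t s ht

/-- **(κ_f) ⟺ its ONE-FIBRE case `Ker j_{t*} ∩ Im j_t^* = 0`**: `j_{t*} j_t^* W = 0 ⟹ j_t^* W = 0` for all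
`p, t, W` (the other fibres follow by `map_fiberι_eq_zero_of_eq_zero`). What remains outside the tree is de
Cataldo's Ex. 8.5.2–8.5.3 fed with Deligne's theorems (global invariant cycles, complete reducibility).
[cite: Decataldo2007, Ex. 8.5.2–8.5.3, Thm. 8.2.4 and Thm. 8.4.1] [cite: DeligneHodgeII1971, Thm. 4.1.1 and 4.2.6] -/
theorem fibreGysinKernelOn_iff_sameFibre {d : ℕ} {f : 𝒳 ⟶ S} (hf : IsCompactAbelianPencil f d) :
    FibreGysinKernelOn hf ↔ ∀ (p : ℕ) (t : ComplexPoints S) (W : complexBetti 𝒳 (2 * p)),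
      fiberGysin hf t p (complexBetti.map (fiberι f t) (2 * p) W) = 0 →
        complexBetti.map (fiberι f t) (2 * p) W = 0 :=
  ⟨fun h p t W hW ↦ h p t t W hW, fun h p t s W hW ↦ map_fiberι_eq_zero_of_eq_zero hf (h p t W hW) s⟩

/-! ## §2 The pointwise node (β′ᵖᵗ): the correspondence may depend on the fibre -/

/-- **(β′ᵖᵗ_f) `FibreClassLefschetzPointwiseOn hf` — POINTWISE fibre-class Lefschetz on ONE compact pencil**: for
every `p ≤ d` and every complex point `t` of the base there is an algebraic correspondence `T_t` of `𝒳` (it may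
depend on `t`) with `j_s^*(T_t(j_{t*} j_t^* W)) = j_s^* W` for all global `W` and all `s`. Weaker-or-equal than part
VIII's `FibreClassLefschetzOn hf` (one `T` for all `t`); sufficient for every lift/transport edge; a consequence
of `HC(𝒳 × 𝒳)` modulo the kernel identity (κ_f) ALONE (`fibreClassLefschetzPointwiseOn_of_hodgeConjectureFor`).
OPEN; a HYPOTHESIS wherever used. [cite: Abdulali1994FamiliesAV, Conjecture 5.3 and Theorem 5.5 (p. 1130)]
[cite: Andre1996Motifs, Remarque 2 (p. 33)] -/
@[conjecture] def FibreClassLefschetzPointwiseOn {d : ℕ} {f : 𝒳 ⟶ S} (hf : IsCompactAbelianPencil f d) : Prop :=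
  ∀ p : ℕ, p ≤ d → ∀ t : ComplexPoints S, ∃ T : complexBetti 𝒳 (2 * (p + 1)) →ₗ[ℂ] complexBetti 𝒳 (2 * p),
    IsAlgebraicCorrespondence (d + 1) (d + 1) 𝒳 𝒳 T ∧
      ∀ (W : complexBetti 𝒳 (2 * p)) (s : ComplexPoints S),
        complexBetti.map (fiberι f s) (2 * p) (T (fiberGysin hf t p (complexBetti.map (fiberι f t) (2 * p) W))) =
          complexBetti.map (fiberι f s) (2 * p) W

/-- **(β∀′ᵖᵗ) `FibreClassLefschetzPointwiseCompactPencils`** — (β′ᵖᵗ_f) for every compact pencil of abelian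
varieties. OPEN; a HYPOTHESIS wherever used; on-path modulo (κ) (`…_of_hodgeConjecture`).
[cite: Andre1996Motifs, Remarque 2 (p. 33)] -/
@[conjecture] def FibreClassLefschetzPointwiseCompactPencils : Prop :=
  ∀ ⦃d : ℕ⦄ ⦃𝒳 S : SchemeOver ℂ⦄ ⦃f : 𝒳 ⟶ S⦄ (hf : IsCompactAbelianPencil f d), FibreClassLefschetzPointwiseOn hf

/-- **(β′ᵖᵗ) `FibreClassLefschetzPointwiseCMPointedPencils`** — (β′ᵖᵗ_f) for the CM-pointed compact pencils.
OPEN; a HYPOTHESIS wherever used. [cite: Andre1996Motifs, Lemme 6.3.1 (p. 31) and Remarque 2 (p. 33)] -/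
@[conjecture] def FibreClassLefschetzPointwiseCMPointedPencils : Prop :=
  ∀ ⦃d : ℕ⦄ ⦃𝒳 S : SchemeOver ℂ⦄ ⦃f : 𝒳 ⟶ S⦄ (hf : IsCompactAbelianPencil f d), (cmLocus f d).Nonempty →
    FibreClassLefschetzPointwiseOn hf

/-- (β′_f) ⟹ (β′ᵖᵗ_f): one correspondence for all fibres is in particular one per fibre. [folklore] -/
theorem fibreClassLefschetzPointwiseOn_of_on {d : ℕ} {f : 𝒳 ⟶ S} (hf : IsCompactAbelianPencil f d)
    (h : FibreClassLefschetzOn hf) : FibreClassLefschetzPointwiseOn hf := by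
  intro p hp t
  obtain ⟨T, hT, hTW⟩ := h p hp
  exact ⟨T, hT, fun W s ↦ hTW W t s⟩

/-- (β∀′) ⟹ (β∀′ᵖᵗ). [folklore] -/
theorem fibreClassLefschetzPointwiseCompactPencils_of_on (h : FibreClassLefschetzOnCompactPencils) :
    FibreClassLefschetzPointwiseCompactPencils :=
  fun _ _ _ _ hf ↦ fibreClassLefschetzPointwiseOn_of_on hf (h hf)

/-- (β′) ⟹ (β′ᵖᵗ) on CM-pointed pencils. [folklore] -/
theorem fibreClassLefschetzPointwiseCMPointedPencils_of_on (h : FibreClassLefschetzOnCMPointedPencils) :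
    FibreClassLefschetzPointwiseCMPointedPencils :=
  fun _ _ _ _ hf hcm ↦ fibreClassLefschetzPointwiseOn_of_on hf (h hf hcm)

/-- (β∀′ᵖᵗ) ⟹ (β′ᵖᵗ). [folklore] -/
theorem fibreClassLefschetzPointwiseCMPointedPencils_of_compactPencils
    (h : FibreClassLefschetzPointwiseCompactPencils) : FibreClassLefschetzPointwiseCMPointedPencils :=
  fun _ _ _ _ hf _ ↦ h hf

/-- **(β′ᵖᵗ_f) ⟹ (κ_f)**: the kernel identity is contained in the pointwise node too.
[cite: Abdulali1994FamiliesAV, Theorem 5.5 (p. 1130)] [cite: HatcherAT2002, §3.3 Thm. 3.26 (c)] -/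
theorem fibreGysinKernelOn_of_fibreClassLefschetzPointwiseOn {d : ℕ} {f : 𝒳 ⟶ S}
    (hf : IsCompactAbelianPencil f d) (hF : FibreClassLefschetzPointwiseOn hf) : FibreGysinKernelOn hf := by
  intro p t s W hW
  by_cases hp : p ≤ d
  · obtain ⟨T, -, hT⟩ := hF p hp t
    rw [← hT W s, hW, map_zero, map_zero]
  · haveI := subsingleton_complexBetti (hf.isSmoothProjective_fiberOver s) (show 2 * d < 2 * p by omega)
    exact Subsingleton.elim _ _

/-! ## §3 The lift engine and the edges for the pointwise node -/

/-- **Engine (pointwise).** On a compact pencil satisfying (β′ᵖᵗ_f), a global class algebraic on ONE fibre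
`𝒳_{s₀}` agrees on every fibre with a global ALGEBRAIC class: `η := T_{s₀}(j_{s₀*} j_{s₀}^* W)` for `p ≤ d`,
`η := 0` for `p > d`. [cite: Abdulali1994FamiliesAV, Theorem 5.5 (p. 1130)] [cite: Milne2020HodgeClassesAV, Prop. 1, proof (pp. 7–8)] -/
theorem exists_algebraic_lift_of_fibreClassLefschetzPointwiseOn {d : ℕ} {f : 𝒳 ⟶ S}
    (hf : IsCompactAbelianPencil f d) (hF : FibreClassLefschetzPointwiseOn hf) {p : ℕ} (W : complexBetti 𝒳 (2 * p))
    {s₀ : ComplexPoints S} (h₀ : complexBetti.map (fiberι f s₀) (2 * p) W ∈ algebraicClasses (fiberOver f s₀) p) :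
    ∃ η ∈ algebraicClasses 𝒳 p, ∀ s : ComplexPoints S,
      complexBetti.map (fiberι f s) (2 * p) η = complexBetti.map (fiberι f s) (2 * p) W := by
  by_cases hp : p ≤ d
  · obtain ⟨T, hT, hTW⟩ := hF p hp s₀
    exact ⟨T (fiberGysin hf s₀ p (complexBetti.map (fiberι f s₀) (2 * p) W)),
      map_mem_algebraicClasses_of_isAlgebraicCorrespondence hf.isSmoothProjective_total hf.isSmoothProjective_total
        hT (fiberGysin_mem_algebraicClasses hf s₀ h₀),
      fun s ↦ hTW W s⟩
  · refine ⟨0, Submodule.zero_mem _, fun s ↦ ?_⟩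
    haveI := subsingleton_complexBetti (hf.isSmoothProjective_fiberOver s) (show 2 * d < 2 * p by omega)
    exact Subsingleton.elim _ _

/-- Transport of algebraicity on a compact pencil satisfying (β′ᵖᵗ_f). [cite: Abdulali1994FamiliesAV, (1.1) (p. 1122) and Theorem 5.5 (p. 1130)] -/
theorem invariantCyclesHoldFor_of_fibreClassLefschetzPointwiseOn {d : ℕ} {f : 𝒳 ⟶ S}
    (hf : IsCompactAbelianPencil f d) (hF : FibreClassLefschetzPointwiseOn hf) : InvariantCyclesHoldFor f d := by
  rintro p W - ⟨s₀, h₀⟩ s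
  obtain ⟨η, hη, hηs⟩ := exists_algebraic_lift_of_fibreClassLefschetzPointwiseOn hf hF W h₀
  exact map_fiberι_mem_algebraicClasses_of_lift hf hη (hηs s) s

/-- **(β∀′ᵖᵗ) ⟹ (L∀)**. [cite: Abdulali1994FamiliesAV, Theorem 5.5 (p. 1130)] -/
theorem algebraicFixedPart_of_fibreClassLefschetzPointwiseCompactPencils
    (h : FibreClassLefschetzPointwiseCompactPencils) : AlgebraicFixedPart := by
  intro d 𝒳 S f hf p W _ s₀ h₀
  obtain ⟨η, hη, hηs⟩ := exists_algebraic_lift_of_fibreClassLefschetzPointwiseOn hf (h hf) W h₀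
  exact ⟨η, hη, hηs s₀⟩

/-- **(β∀′ᵖᵗ) ⟹ (2)** (transport on every compact pencil). [cite: Milne2020HodgeClassesAV, Thm. 4 and Prop. 1 (pp. 7–8)] -/
theorem compactAbelianPencilVHC_of_fibreClassLefschetzPointwiseCompactPencils
    (h : FibreClassLefschetzPointwiseCompactPencils) : CompactAbelianPencilVHC :=
  fun _ _ _ _ hf ↦ invariantCyclesHoldFor_of_fibreClassLefschetzPointwiseOn hf (h hf)

/-- **(β′ᵖᵗ) ⟹ (L)** (lift at CM fibres of CM-pointed pencils). [cite: Abdulali1994FamiliesAV, Theorem 5.5 (p. 1130)] -/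
theorem cmFibreAlgebraicLift_of_fibreClassLefschetzPointwiseCMPointedPencils
    (h : FibreClassLefschetzPointwiseCMPointedPencils) : CMFibreAlgebraicLift := by
  intro d 𝒳 S f hf p W _ t ht h₀
  obtain ⟨η, hη, hηs⟩ := exists_algebraic_lift_of_fibreClassLefschetzPointwiseOn hf (h hf ⟨t, ht⟩) W h₀
  exact ⟨η, hη, hηs t⟩

/-- **(β′ᵖᵗ) ⟹ (3)**. [cite: Abdulali1994FamiliesAV, (1.1) and p. 1122] -/
theorem cmPointedPencilVHC_of_fibreClassLefschetzPointwiseCMPointedPencils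
    (h : FibreClassLefschetzPointwiseCMPointedPencils) : CMPointedPencilVHC :=
  fun _ _ _ _ hf hcm ↦ invariantCyclesHoldFor_of_fibreClassLefschetzPointwiseOn hf (h hf hcm)

/-- **(β′ᵖᵗ) ⟹ (4)** (through (L)). [cite: Andre1996Motifs, §6.3 a) (p. 33)] -/
theorem cmAnchoredTransport_of_fibreClassLefschetzPointwiseCMPointedPencils
    (h : FibreClassLefschetzPointwiseCMPointedPencils) : CMAnchoredTransport :=
  cmAnchoredTransport_of_cmFibreAlgebraicLift (cmFibreAlgebraicLift_of_fibreClassLefschetzPointwiseCMPointedPencils h)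

/-- **`HC_CM → (β′ᵖᵗ) → HC_AV` modulo Lemme 6.3.1 only** (the row of part VIII for the pointwise node).
research route, not a corollary; conditional on HC_CM plus one named minimal statement.
[cite: Andre1996Motifs, Lemme 6.3.1 (p. 31) and §6.3 a) (p. 33)] -/
theorem HC_AV_of_HC_CM_and_fibreClassLefschetzPointwiseCMPointedPencils (h₂₁ : andre1996_cmAnchoredPencil)
    (hCM : RankFourFaces.CMAbelianHodge) (hF : FibreClassLefschetzPointwiseCMPointedPencils) :
    PadicSemiregularLift.HodgeAbelianVarieties :=
  HC_AV_of_HC_CM_and_cmFibreAlgebraicLift h₂₁ hCM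
    (cmFibreAlgebraicLift_of_fibreClassLefschetzPointwiseCMPointedPencils hF)

/-! ## §4 On-path modulo (κ) ALONE, and `HC ⊢ (β∀′ᵖᵗ) ⟺ (κ)` -/

/-- **`HC(𝒳 × 𝒳) ∧ (κ_f) ⟹ (β′ᵖᵗ_f)` — no fibre-class constancy**: at each `t` take the ALGEBRAIC quasi-inverse
`T_t` of `L_t` of part X-b (`exists_algebraic_quasiInverse_fiberGysin_of_hodgeConjectureFor`: semisimplicity of
polarisable Hodge structures + Voisin I Lemma 11.41 + `HC(𝒳 × 𝒳)`); `L_t(T_t L_t W − W) = 0`, so by (κ_f)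
`j_s^*(T_t L_t W − W) = 0`. [cite: Voisin2025, Prop. 2.11 and §3.2.2] [cite: VoisinHodgeI2002, §11.3.3 Lemma 11.41]
[cite: DeligneHodgeII1971, Thm. 4.1.1 and 4.2.6] -/
theorem fibreClassLefschetzPointwiseOn_of_hodgeConjectureFor {d : ℕ} {f : 𝒳 ⟶ S} (hf : IsCompactAbelianPencil f d)
    (hκ : FibreGysinKernelOn hf) (hHC : HodgeConjectureFor ((d + 1) + (d + 1)) (𝒳 ⊗ 𝒳)) :
    FibreClassLefschetzPointwiseOn hf := by
  intro p hp t
  obtain ⟨T, hT, hTL⟩ := exists_algebraic_quasiInverse_fiberGysin_of_hodgeConjectureFor hf hHC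
    (show p ≤ d + 1 by omega) t
  refine ⟨T, hT, fun W s ↦ ?_⟩
  rw [← sub_eq_zero, ← map_sub]
  refine hκ p t s _ ?_
  rw [map_sub, map_sub, hTL W, sub_self]

/-- **ON-PATH for (β∀′ᵖᵗ) modulo (κ) alone: `HodgeConjecture → FibreGysinKernelCompactPencils →
FibreClassLefschetzPointwiseCompactPencils`.** [cite: Andre1996Motifs, §6.3 Remarque 2 (p. 33)]
[cite: Voisin2025, Prop. 2.11 and §3.2.2] [cite: DeligneHodgeII1971, Thm. 4.1.1 and 4.2.6] -/
theorem fibreClassLefschetzPointwiseCompactPencils_of_hodgeConjecture (hκ : FibreGysinKernelCompactPencils)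
    (h : _root_.HodgeConjecture) : FibreClassLefschetzPointwiseCompactPencils :=
  fun _ _ _ _ hf ↦ fibreClassLefschetzPointwiseOn_of_hodgeConjectureFor hf (hκ hf)
    (h (IsSmoothProjective.tensor_holds hf.isSmoothProjective_total hf.isSmoothProjective_total))

/-- (β∀′ᵖᵗ) ⟹ (κ) universally. [cite: Abdulali1994FamiliesAV, Theorem 5.5 (p. 1130)] -/
theorem fibreGysinKernelCompactPencils_of_fibreClassLefschetzPointwiseCompactPencils
    (h : FibreClassLefschetzPointwiseCompactPencils) : FibreGysinKernelCompactPencils :=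
  fun _ _ _ _ hf ↦ fibreGysinKernelOn_of_fibreClassLefschetzPointwiseOn hf (h hf)

/-- **Under the Hodge conjecture the pointwise fibre-class Lefschetz node IS Deligne's invariant-cycle kernel
identity: `HodgeConjecture → ((β∀′ᵖᵗ) ↔ (κ))`.** So the only distance of this Lefschetz-type node from "a case
of the summit, fact-free" is the tree's missing E₂-degeneration / semisimplicity package (κ) — no
cycle-theoretic input. [cite: DeligneHodgeII1971, Thm. 4.1.1 and 4.2.6] [cite: Decataldo2007, Thm. 8.2.4, Thm. 8.4.1 and Ex. 8.5.2–8.5.3]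
[cite: Andre1996Motifs, §6.3 Remarque 2 (p. 33)] -/
theorem fibreClassLefschetzPointwiseCompactPencils_iff_kernel_of_hodgeConjecture (h : _root_.HodgeConjecture) :
    FibreClassLefschetzPointwiseCompactPencils ↔ FibreGysinKernelCompactPencils :=
  ⟨fibreGysinKernelCompactPencils_of_fibreClassLefschetzPointwiseCompactPencils,
    fun hκ ↦ fibreClassLefschetzPointwiseCompactPencils_of_hodgeConjecture hκ h⟩

/-- Per pencil: `HC(𝒳 × 𝒳) ⊢ (β′ᵖᵗ_f) ⟺ (κ_f)`. [cite: DeligneHodgeII1971, Thm. 4.1.1 and 4.2.6] -/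
theorem fibreClassLefschetzPointwiseOn_iff_kernel_of_hodgeConjectureFor {d : ℕ} {f : 𝒳 ⟶ S}
    (hf : IsCompactAbelianPencil f d) (hHC : HodgeConjectureFor ((d + 1) + (d + 1)) (𝒳 ⊗ 𝒳)) :
    FibreClassLefschetzPointwiseOn hf ↔ FibreGysinKernelOn hf :=
  ⟨fibreGysinKernelOn_of_fibreClassLefschetzPointwiseOn hf, fun hκ ↦ fibreClassLefschetzPointwiseOn_of_hodgeConjectureFor hf hκ hHC⟩

/-- **Under the Hodge conjecture, (κ) alone gives the whole transport ladder of the André axis through a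
Lefschetz-type node**: (β∀′ᵖᵗ), (L∀), (2), (L), (3), (4). (The ladder (L∀)…(4) is already a fact-free consequence of
`HodgeConjecture` by part VI's Hodge lift; new here is that the LEFSCHETZ-type node joins it modulo (κ).)
[cite: Andre1996Motifs, §6.3 Remarque 2 (p. 33)] -/
theorem lefschetzLadder_of_hodgeConjecture_of_kernel (hκ : FibreGysinKernelCompactPencils)
    (h : _root_.HodgeConjecture) :
    FibreClassLefschetzPointwiseCompactPencils ∧ AlgebraicFixedPart ∧ CompactAbelianPencilVHC ∧
      CMFibreAlgebraicLift ∧ CMPointedPencilVHC ∧ CMAnchoredTransport :=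
  have hP := fibreClassLefschetzPointwiseCompactPencils_of_hodgeConjecture hκ h
  have hP' := fibreClassLefschetzPointwiseCMPointedPencils_of_compactPencils hP
  ⟨hP, algebraicFixedPart_of_fibreClassLefschetzPointwiseCompactPencils hP,
    compactAbelianPencilVHC_of_fibreClassLefschetzPointwiseCompactPencils hP,
    cmFibreAlgebraicLift_of_fibreClassLefschetzPointwiseCMPointedPencils hP',
    cmPointedPencilVHC_of_fibreClassLefschetzPointwiseCMPointedPencils hP',
    cmAnchoredTransport_of_fibreClassLefschetzPointwiseCMPointedPencils hP'⟩

end Summit.HodgeConjecture.HodgeConjecture.Ring2.AbelianAll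

end
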